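import Literature.IUT.HodgeTheaters.InitialThetaData
import Literature.IUT.HodgeTheaters.ThetaHodgeTheatersRemarksA
import HarnessLib

/-!
# [IUTchI] Remark 3.1.3 for the tree's `InitialThetaData` (merge of the abstract typing)

S. Mochizuki, *Inter-universal Teichmüller theory I*, §3, Remark 3.1.3 (kurims p. 65)
[claim: Mochizuki2012, status: disputed]: "Since `V^bad_mod ≠ ∅`, it follows immediately from
Definition 3.1, (d), (e), (f), that the data `(F/F̄, X_F, l, C_K, V, V^bad_mod, ε)` is, in fact,
completely determined by the data `(F/F̄, X_F, C_K, V, V^bad_mod)`, and that `C_K` is completely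
determined up to `K`-isomorphism by the data `(F/F̄, X_F, l, V)`."

`ThetaHodgeTheatersRemarksA.lean` typed these two claims ABSTRACTLY, as predicates
`ThetaDataShape.DeterminedByFive` / `CKDeterminedUpToIso` over an admissibility predicate on the
shape of a 7-tuple (TODO-merge:abc-iut-L5-t2).  This proof-only file performs the merge against the
landed Definition 3.1, `InitialThetaData F K Fbar E l P` (`InitialThetaData.lean`, seat abc-iut-L5-t2):
in that encoding `F/F̄`, `X_F = E` and `l` are type-level parameters, `C_K` (with the cusp data
`ε⁰, ε′, ε″, 2ε̲` of §1, hence `ε̲`) is the geometry datum `D.geom : ThetaGeometry … l`, and `V`,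
`V^bad_mod` are the fields `D.V`, `D.VbadMod`; every other field is a proposition.  Consequently the
FIRST determination claim is STRUCTURAL and is PROVED here:

* `InitialThetaData.eq_of_geom_V_VbadMod`: two collections of initial Θ-data of the same type with
  the same `(C_K-datum, V, V^bad_mod)` are equal;
* `InitialThetaData.l_eq_relIndex`: `l` is recovered from the `C_K`-datum as the degree
  `[Π_{X_K} : Π_{X̲_K}]` (Def. 3.1 (d) "of type `(1, l-tors)`");
* `InitialThetaData.determinedByFive`: the abstract predicate `ThetaDataShape.DeterminedByFive`
  holds for the admissibility predicate "is the shape of some `D : InitialThetaData F K Fbar E l P`".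

Theorems only (proof-lane companion); no new definitions.

The SECOND claim ("`C_K` is determined up to `K`-isomorphism by `(F/F̄, X_F, l, V)`") is a
geometric uniqueness statement about the `K`-core `C_K`; the tree carries `C_K` only as interface
data (`ThetaGeometry`), so it stays the abstract predicate `ThetaDataShape.CKDeterminedUpToIso` and is
not instantiated here (nothing is asserted).  Seat abc-iut-L3-t8 (row W2-L5-01a).
-/

namespace Literature.IUT.HodgeTheaters

namespace InitialThetaData

universe u v w

variable {F : Type u} {K : Type v} {Fbar : Type w} [Field F] [NumberField F] [Field K]
  [NumberField K] [Algebra F K] [Field Fbar] [Algebra F Fbar] [Algebra K Fbar]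
  {E : WeierstrassCurve F} [E.IsElliptic] {l : ℕ} {P : BadPlacePredicates K}

/-- Rmk 3.1.3, first claim, in the tree's encoding of Def. 3.1: a collection of initial Θ-data
`D : InitialThetaData F K Fbar E l P` is determined by its `C_K`-datum `D.geom`, its `V` and its
`V^bad_mod` (all remaining fields are propositions). PROVED. [claim: Mochizuki2012, status: disputed] -/
theorem eq_of_geom_V_VbadMod (D D' : InitialThetaData F K Fbar E l P) (hg : D.geom = D'.geom)
    (hV : D.V = D'.V) (hb : D.VbadMod = D'.VbadMod) : D = D' := by
  cases D
  cases D'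
  cases hg
  cases hV
  cases hb
  rfl

/-- Rmk 3.1.3 ("`l` … determined by … `C_K`"): `l` is the degree `[Π_{X_K} : Π_{X̲_K}]` read off
from the `C_K`-datum (Def. 3.1 (d): "`X̲_K` of type `(1, l-tors)`"). PROVED (it is the field
`ThetaGeometry.PiXbar_relIndex`). [claim: Mochizuki2012, status: disputed] -/
theorem l_eq_relIndex (D : InitialThetaData F K Fbar E l P) :
    l = D.geom.pe.PiXbar.relIndex D.geom.pe.PiX :=
  D.geom.PiXbar_relIndex.symm

/-- Rmk 3.1.3, first claim, as the abstract predicate of `ThetaHodgeTheatersRemarksA.lean`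
instantiated at the admissibility predicate "is the shape of some collection of initial Θ-data of
type `InitialThetaData F K Fbar E l P`" — the SHAPE of `D` being the 7-tuple whose type-level
components `F/F̄`, `X_F` contribute nothing (`PUnit`), with `l` the parameter, `C_K` the geometry
datum `D.geom` (which carries the cusp `ε̲` through the §1 data `pe`, so the `ε`-slot is `PUnit` as
well), and `V`, `V^bad_mod` the fields. PROVED. [claim: Mochizuki2012, status: disputed] -/
theorem determinedByFive :
    ThetaDataShape.DeterminedByFive
      (fun S => ∃ D : InitialThetaData F K Fbar E l P,
        ThetaDataShape.mk PUnit.unit PUnit.unit l D.geom D.V D.VbadMod PUnit.unit = S) := by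
  rw [ThetaDataShape.determinedByFive_iff]
  rintro S S' ⟨D, rfl⟩ ⟨D', rfl⟩ _ _ hCK hV hb
  simp only at hCK hV hb ⊢
  rw [hCK, hV, hb]

end InitialThetaData

end Literature.IUT.HodgeTheaters
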